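import Literature.NumberTheory.Automorphic.UnitaryGroupBorelSemidirect
import Literature.NumberTheory.Automorphic.IdeleNormOneSplitting
import Literature.NumberTheory.Automorphic.UnitaryGroupAdelicCenterRational
import HarnessLib

/-!
# Torus coordinates for the Siegel set of the quasi-split `U(J₃)`: idele covers and rational torus elements

Topic `NumberTheory/Automorphic`; namespace `Literature.NumberTheory.Automorphic.UnitaryGroup`.  THEOREMS ONLY (no
definition, no named fact, no instance, no notation, no `sorry`).  Setting: `E/F` a quadratic extension of number fields
with non-trivial automorphism `c` (`Module.finrank F E = 2`, `c ≠ 1`), Mok's quasi-split unitary group `U(J₃) = quasiSplit F E c 3`,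
its adelic Borel subgroup `B(𝔸_F) = borelAdelic F E c 3` with torus part `torusPart` and diagonal entries `diagUnit`
(★ `UnitaryGroupBorelSemidirect`).  The torus is `T(𝔸_F) = {diag(d₀, d₁, d₂) : d₂ = (c d₀)⁻¹, c(d₁) d₁ = 1}`
(★ `mem_torusAdelic_iff`); reduction theory for `T(F)\T(𝔸_F)` therefore needs exactly two idelic covers:

* §1 `exists_isCompact_forall_exists_mul_mem` — a locally compact group with compact quotient `G ⧸ Γ` is `C · Γ` with `C`
  compact; `exists_isCompact_adelicOne_cover` — **the anisotropic torus `U(1)_{E/F}`**: a compact `W₁ ⊆ U(1)(𝔸_F) = adelicOne`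
  with `U(1)(𝔸_F) = W₁ · U(1)(F)` (★ `compactSpace_relNormOneQuot`, ★ `adelicOne_eq_relNormOneIdeles`);
  `exists_isCompact_normOne_ray_cover` — **the split torus**: a compact `W₀ ⊆ 𝕀_E¹` with
  `𝕀_E = W₀ · ι(Eˣ) · ρ(ℝ_{>0})`, i.e. `x ι(k) = w ρ(e^s)` (★ `exists_isCompact_normOne_cover`, ★ `normOneRetraction`).
* §2 scalars: `‖ρ(e^s)‖_𝔸 = e^{[E:ℚ] s}`, the archimedean components of `ρ(e^s)` have norm `e^s`, `c • ρ(r) = ρ(r)`,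
  continuity of `y ↦ c • y` on `𝕀_E`.
* §3 torus elements of `U(J₃)`: the relations `c(d₂) d₀ = 1`, `c(d₁) d₁ = 1` of a torus element (`diagUnit_rel_of_torusPart_eq`),
  `d₂ = (c • d₀)⁻¹`, `d₁ ∈ U(1)(𝔸_F)`, and **the rational torus element `diag(k, q, (c k)⁻¹) ∈ T(F)`** for `k ∈ Eˣ`,
  `q ∈ E¹` (`exists_rational_torus`): an element of `B(𝔸_F) ∩ G(F)` with prescribed diagonal entries `ι(k), ι(q)`.

These are the letters of the torus Siegel set `S_T` of the companion file `UnitaryGroupTorusSiegelSet` (brick H9a of the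
cell's T1-qs law `TruncatedKernelIntegrable`; Rogawski (1990), §2.2: Siegel sets `ω A_t K` for `U(3)`; Godement's
compactness criterion for the anisotropic `U(1)`).  HC_CM is proved only modulo the printed citations until rung 0 closes.

## References
* J. D. Rogawski, *Automorphic Representations of Unitary Groups in Three Variables* (1990), §1.10, §2.2 [Rogawski1990].
* J. W. S. Cassels, A. Fröhlich (eds.), *Algebraic Number Theory* (1967), Ch. II §16 [CasselsFrohlichANT1967].
* R. Godement, *Domaines fondamentaux des groupes arithmétiques*, Sém. Bourbaki 257 (1964), §5 Thm. 4 [Godement1964].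
-/

set_option autoImplicit false

noncomputable section

open NumberField IsDedekindDomain Matrix Topology
open scoped NNReal Pointwise

namespace Literature.NumberTheory.Automorphic

namespace UnitaryGroup

/-! ## §1 Compact covers: `G = C · Γ`, the anisotropic torus `U(1)_{E/F}`, the split torus `𝕀_E` -/

section Covers

/-- **a locally compact group with compact quotient `G ⧸ Γ` is `C · Γ` with `C` compact**: every `g` is `g γ ∈ C` for
some `γ ∈ Γ`. [cite: Godement1964, §5 Thm. 4] -/
theorem exists_isCompact_forall_exists_mul_mem {G : Type*} [Group G] [TopologicalSpace G] [IsTopologicalGroup G]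
    [LocallyCompactSpace G] (Γ : Subgroup G) [CompactSpace (G ⧸ Γ)] :
    ∃ C : Set G, IsCompact C ∧ ∀ g : G, ∃ γ ∈ Γ, g * γ ∈ C := by
  obtain ⟨K, hK, h1K⟩ := exists_compact_mem_nhds (1 : G)
  -- the open cover of `G ⧸ Γ` by the images of the translates `g · interior K`
  have hcov : (Set.univ : Set (G ⧸ Γ)) ⊆ ⋃ g : G, (QuotientGroup.mk : G → G ⧸ Γ) '' ((g * ·) '' interior K) := by
    intro q _
    obtain ⟨g, rfl⟩ := QuotientGroup.mk_surjective q
    refine Set.mem_iUnion.2 ⟨g, ⟨g * 1, ⟨1, mem_interior_iff_mem_nhds.2 h1K, rfl⟩, by rw [mul_one]⟩⟩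
  have hopen : ∀ g : G, IsOpen ((QuotientGroup.mk : G → G ⧸ Γ) '' ((g * ·) '' interior K)) := fun g =>
    QuotientGroup.isOpenMap_coe _ ((Homeomorph.mulLeft g).isOpenMap _ isOpen_interior)
  obtain ⟨s, hs⟩ := isCompact_univ.elim_finite_subcover _ hopen hcov
  refine ⟨⋃ g ∈ s, (g * ·) '' K, s.isCompact_biUnion fun g _ => hK.image (continuous_const.mul continuous_id), fun x => ?_⟩
  obtain ⟨g, hg, y, ⟨k, hk, rfl⟩, hxy⟩ := Set.mem_iUnion₂.1 (hs (Set.mem_univ (QuotientGroup.mk x)))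
  -- `mk (g k) = mk x`, so `γ := x⁻¹ (g k) ∈ Γ` and `x γ = g k ∈ g K`
  refine ⟨x⁻¹ * (g * k), ?_, ?_⟩
  · exact QuotientGroup.eq.1 hxy.symm
  · rw [mul_inv_cancel_left]
    exact Set.mem_iUnion₂.2 ⟨g, hg, k, interior_subset hk, rfl⟩

variable (F E : Type) [Field F] [NumberField F] [Field E] [NumberField E] [Algebra F E] (c : E ≃ₐ[F] E)

/-- `principalIdele` is the diagonal embedding of units (definitional). [cite: CasselsFrohlichANT1967, Ch. II §16] -/
theorem principalIdele_eq_unitsMap (k : Eˣ) :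
    principalIdele E k = Units.map (algebraMap E (AdeleRing (𝓞 E) E) : E →* AdeleRing (𝓞 E) E) k := rfl

/-- **compact cover of the anisotropic torus `U(1)_{E/F}(𝔸_F) = W₁ · U(1)(F)`** (Godement's criterion for the norm-one
torus of a quadratic extension, in the `adelicOne` currency of `U(J_N)`): a compact `W₁ ⊆ U(1)(𝔸_F)` such that every
`y ∈ U(1)(𝔸_F)` is moved into `W₁` by a principal idele of `U(1)(F)`. [cite: Godement1964, §5 Thm. 4] -/
theorem exists_isCompact_adelicOne_cover (h2 : Module.finrank F E = 2) (hc1 : c ≠ 1) :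
    ∃ W₁ : Set (AdeleRing (𝓞 E) E)ˣ, IsCompact W₁ ∧ W₁ ⊆ (adelicOne F E c : Set (AdeleRing (𝓞 E) E)ˣ) ∧
      ∀ y ∈ adelicOne F E c, ∃ q : Eˣ, principalIdele E q ∈ adelicOne F E c ∧ y * principalIdele E q ∈ W₁ := by
  haveI : FiniteDimensional F E := Module.finite_of_finrank_eq_succ h2
  have hone : adelicOne F E c = relNormOneIdeles F E := adelicOne_eq_relNormOneIdeles F E c h2 hc1
  obtain ⟨C, hC, hcov⟩ := exists_isCompact_forall_exists_mul_mem (relNormOneRat F E)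
  refine ⟨((↑) : relNormOneIdeles F E → (AdeleRing (𝓞 E) E)ˣ) '' C, hC.image continuous_subtype_val, ?_, ?_⟩
  · rintro _ ⟨g, -, rfl⟩
    rw [hone]
    exact g.2
  · intro y hy
    rw [hone] at hy
    obtain ⟨γ, hγ, hgγ⟩ := hcov ⟨y, hy⟩
    obtain ⟨q, hq⟩ := (mem_relNormOneRat_iff F E γ).1 hγ
    have hq' : principalIdele E q = ((γ : relNormOneIdeles F E) : (AdeleRing (𝓞 E) E)ˣ) := by
      rw [principalIdele_eq_unitsMap]; exact hq
    refine ⟨q, ?_, ⟨_, hgγ, ?_⟩⟩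
    · rw [hone, hq']; exact γ.2
    · rw [hq']; rfl

/-- `e^{log u} = u` for a positive unit of `ℝ≥0`. [folklore] -/
private theorem expUnitNNReal_log' (u : ℝ≥0ˣ) : expUnitNNReal (Real.log ((u : ℝ≥0) : ℝ)) = u :=
  Units.ext (NNReal.eq (by
    rw [coe_expUnitNNReal]
    exact Real.exp_log (NNReal.coe_pos.2 (pos_iff_ne_zero.2 u.ne_zero))))

/-- **the split torus: `𝕀_E = W₀ · ι(Eˣ) · ρ(ℝ_{>0})`** with `W₀ ⊆ 𝕀_E¹` compact — every idele `x` has `x ι(k) = w ρ(e^s)`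
with `w ∈ W₀`, `k ∈ Eˣ`, `s ∈ ℝ` (`J¹/Eˣ` compact and the retraction onto `J¹`). [cite: CasselsFrohlichANT1967, Ch. II §16] -/
theorem exists_isCompact_normOne_ray_cover :
    ∃ W₀ : Set (AdeleRing (𝓞 E) E)ˣ, IsCompact W₀ ∧ (∀ w ∈ W₀, IdeleClassGroup.ideleNorm E w = 1) ∧
      ∀ x : (AdeleRing (𝓞 E) E)ˣ, ∃ w ∈ W₀, ∃ k : Eˣ, ∃ s : ℝ,
        x * principalIdele E k = w * posRealIdele E (expUnitNNReal s) := by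
  obtain ⟨W, hWc, hW1, hcov, -⟩ := exists_isCompact_normOne_cover E
  refine ⟨W, hWc, hW1, fun x => ?_⟩
  obtain ⟨t, ht⟩ := normOneRetraction_inv_mul_mem E x
  obtain ⟨k, w, hw, hxw⟩ := hcov (normOneRetraction E x) (ideleNorm_normOneRetraction E x)
  refine ⟨w, hw, k⁻¹, Real.log (((t : ℝ≥0ˣ) : ℝ≥0) : ℝ), ?_⟩
  rw [expUnitNNReal_log', ht, hxw, map_inv, mul_inv, mul_assoc, mul_inv_cancel_left, mul_comm]

end Covers

/-! ## §2 Scalars: the ray `ρ(e^s)`, its norm and archimedean components, the Galois action on `𝕀_E` -/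

section Scalars

variable (F E : Type) [Field F] [NumberField F] [Field E] [NumberField E] [Algebra F E] (c : E ≃ₐ[F] E)

omit [NumberField F] in
/-- `‖ρ(e^s)‖_𝔸 = e^{[E:ℚ] s}`. [cite: CasselsFrohlichANT1967, Ch. II §16] -/
theorem ideleNorm_posRealIdele_expUnitNNReal (s : ℝ) :
    IdeleClassGroup.ideleNorm E (posRealIdele E (expUnitNNReal s)) =
      ((expUnitNNReal (Module.finrank ℚ E * s) : ℝ≥0ˣ) : ℝ≥0) := by
  rw [ideleNorm_posRealIdele_holds E]
  apply NNReal.eq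
  rw [NNReal.coe_pow, coe_expUnitNNReal, coe_expUnitNNReal, ← Real.exp_nat_mul]

omit [NumberField F] in
/-- the archimedean components of `ρ(e^s)` have norm `e^s`. [cite: CasselsFrohlichANT1967, Ch. II §16] -/
theorem norm_posRealIdele_expUnitNNReal_fst_apply (s : ℝ) (w : InfinitePlace E) :
    ‖((posRealIdele E (expUnitNNReal s) : (AdeleRing (𝓞 E) E)ˣ) : AdeleRing (𝓞 E) E).1 w‖ = Real.exp s := by
  rw [← coe_nnnorm, nnnorm_posRealIdele_fst_apply, coe_expUnitNNReal]

omit [NumberField F] in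
/-- `y ↦ c • y` is continuous on `𝕀_E` (`c ⊗ 1` is continuous on `𝔸_E`). [cite: CasselsFrohlichANT1967, Ch. VII §1.1] -/
theorem continuous_galSmul_idele : Continuous fun y : (AdeleRing (𝓞 E) E)ˣ => c • y := by
  refine Units.continuous_iff.2 ⟨?_, ?_⟩
  · have : (Units.val ∘ fun y : (AdeleRing (𝓞 E) E)ˣ => c • y) =
        fun y : (AdeleRing (𝓞 E) E)ˣ => conjAdele F E c ↑y := funext fun y => val_smul_eq_conjAdele F E c y
    rw [this]
    exact (continuous_conjAdele F E c).comp Units.continuous_val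
  · have : (fun y : (AdeleRing (𝓞 E) E)ˣ => ↑(c • y)⁻¹) =
        fun y : (AdeleRing (𝓞 E) E)ˣ => conjAdele F E c ↑(y⁻¹) := funext fun y => by
      show (((c • y)⁻¹ : (AdeleRing (𝓞 E) E)ˣ) : AdeleRing (𝓞 E) E) = conjAdele F E c ↑(y⁻¹)
      rw [← smul_inv', val_smul_eq_conjAdele]
    rw [this]
    exact (continuous_conjAdele F E c).comp Units.continuous_coe_inv

end Scalars

/-! ## §3 Torus elements of `U(J₃)`: relations of the diagonal entries, the rational torus -/

section Torus

variable {F E : Type} [Field F] [NumberField F] [Field E] [NumberField E] [Algebra F E] {c : E ≃ₐ[F] E}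

/-- for a torus element `t` the matrix of `t` is `diag(diagUnit t)` (★ `adelicVal_torusPart` at `torusPart t = t`).
[cite: Rogawski1990, §1.10] -/
theorem adelicVal_eq_glDiagonal_diagUnit {N : ℕ} {t : borelAdelic F E c N} (ht : torusPart t = t) :
    adelicVal F E c N _ (t : (quasiSplit F E c N).Adelic) = glDiagonal N (AdeleRing (𝓞 E) E) (diagUnit t.2) := by
  conv_lhs => rw [← ht]
  exact adelicVal_torusPart t

/-- **the torus relations**: `c(d_{rev i}) d_i = 1` for a torus element `t = diag(d)` of `U(J_N)`.
[cite: Rogawski1990, §1.10] -/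
theorem conjAdele_diagUnit_rev_mul {N : ℕ} {t : borelAdelic F E c N} (ht : torusPart t = t) (i : Fin N) :
    conjAdele F E c ((diagUnit t.2 (Fin.rev i) : (AdeleRing (𝓞 E) E)ˣ) : AdeleRing (𝓞 E) E) *
      ((diagUnit t.2 i : (AdeleRing (𝓞 E) E)ˣ) : AdeleRing (𝓞 E) E) = 1 := by
  have h := adelicVal_mem_unitaryGroupOfForm (t : (quasiSplit F E c N).Adelic)
  rw [adelicVal_eq_glDiagonal_diagUnit ht] at h
  exact (glDiagonal_mem_unitaryGroupOfForm_antidiagonal_iff _ N _).1 h i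

/-- for `U(J₃)`: **`d₂ = (c • d₀)⁻¹`**. [cite: Rogawski1990, §1.10] -/
theorem diagUnit_two_eq {t : borelAdelic F E c 3} (ht : torusPart t = t) :
    diagUnit t.2 2 = (c • diagUnit t.2 0)⁻¹ := by
  have h := conjAdele_diagUnit_rev_mul ht 2
  have hrev : Fin.rev (2 : Fin 3) = 0 := by decide
  rw [hrev] at h
  rw [eq_inv_iff_mul_eq_one]
  refine Units.ext ?_
  rw [Units.val_mul, val_smul_eq_conjAdele, Units.val_one, mul_comm]
  exact h

/-- for `U(J₃)`: **`d₁ ∈ U(1)(𝔸_F)`** (`c(d₁) d₁ = 1`). [cite: Rogawski1990, §1.10] -/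
theorem diagUnit_one_mem_adelicOne {t : borelAdelic F E c 3} (ht : torusPart t = t) :
    diagUnit t.2 1 ∈ adelicOne F E c := by
  rw [mem_adelicOne_iff]
  have h := conjAdele_diagUnit_rev_mul ht 1
  have hrev : Fin.rev (1 : Fin 3) = 1 := by decide
  rwa [hrev] at h

/-- **the rational torus element `diag(k, q, (c k)⁻¹) ∈ T(F)`** (`k ∈ Eˣ`, `q ∈ E¹`, `c² = 1`) as an element of `B(𝔸_F)`
lying in the arithmetic subgroup, with prescribed diagonal entries. [cite: Rogawski1990, §1.10] -/
theorem exists_rational_torus (hcc : ∀ x : E, c (c x) = x) (k q : Eˣ) (hq : c (q : E) * q = 1) :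
    ∃ τ : borelAdelic F E c 3, (τ : (quasiSplit F E c 3).Adelic) ∈ (quasiSplit F E c 3).arithmeticSubgroup ∧
      torusPart τ = τ ∧ diagUnit τ.2 0 = principalIdele E k ∧ diagUnit τ.2 1 = principalIdele E q := by
  -- the rational diagonal
  have hck : c (k : E) ≠ 0 := by rw [Ne, map_eq_zero_iff c c.injective]; exact k.ne_zero
  set kv : Fin 3 → Eˣ := ![k, q, (Units.mk0 (c (k : E)) hck)⁻¹] with hkv
  have hkv0 : kv 0 = k := rfl
  have hkv1 : kv 1 = q := rfl
  have hkv2 : kv 2 = (Units.mk0 (c (k : E)) hck)⁻¹ := rfl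
  have hmem : glDiagonal 3 E kv ∈ rational F E c 3 ((StdForm.antidiagonal 3).over E) := by
    refine (glDiagonal_mem_unitaryGroupOfForm_antidiagonal_iff (c : E →+* E) 3 kv).2 fun i => ?_
    fin_cases i
    · show c ((kv (Fin.rev 0) : Eˣ) : E) * ((kv 0 : Eˣ) : E) = 1
      rw [show Fin.rev (0 : Fin 3) = 2 by decide, hkv2, hkv0, Units.val_inv_eq_inv_val, Units.val_mk0, map_inv₀, hcc,
        inv_mul_cancel₀ k.ne_zero]
    · show c ((kv (Fin.rev 1) : Eˣ) : E) * ((kv 1 : Eˣ) : E) = 1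
      rw [show Fin.rev (1 : Fin 3) = 1 by decide, hkv1]; exact hq
    · show c ((kv (Fin.rev 2) : Eˣ) : E) * ((kv 2 : Eˣ) : E) = 1
      rw [show Fin.rev (2 : Fin 3) = 0 by decide, hkv0, hkv2, Units.val_inv_eq_inv_val, Units.val_mk0,
        mul_inv_cancel₀ hck]
  set γ : rational F E c 3 ((StdForm.antidiagonal 3).over E) := ⟨glDiagonal 3 E kv, hmem⟩ with hγ
  set τA : (quasiSplit F E c 3).Adelic := (quasiSplit F E c 3).toAdelic γ with hτA
  -- its adelic matrix is the diagonal of principal ideles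
  have hval : adelicVal F E c 3 _ τA = glDiagonal 3 (AdeleRing (𝓞 E) E) (fun i => principalIdele E (kv i)) := by
    refine Units.ext ?_
    change (((toAdelic F E c 3 _ γ : adelic F E c 3 _) : GL (Fin 3) (AdeleRing (𝓞 E) E)) :
        Matrix (Fin 3) (Fin 3) (AdeleRing (𝓞 E) E)) = _
    rw [coe_toAdelic, coe_glDiagonal]
    change ((glDiagonal 3 E kv : GL (Fin 3) E) : Matrix (Fin 3) (Fin 3) E).map _ = _
    rw [coe_glDiagonal, Matrix.diagonal_map (map_zero _)]
    rfl
  have hτB : τA ∈ borelAdelic F E c 3 := by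
    rw [mem_borelAdelic_iff, hval, coe_glDiagonal]
    exact Matrix.blockTriangular_diagonal _
  have hτT : τA ∈ torusAdelic F E c 3 := ⟨_, hval.symm⟩
  refine ⟨⟨τA, hτB⟩, ⟨γ, rfl⟩, torusPart_eq_self_of_mem hτT, ?_, ?_⟩
  · refine Units.ext ?_
    rw [coe_diagUnit]
    change (adelicVal F E c 3 _ τA : Matrix (Fin 3) (Fin 3) (AdeleRing (𝓞 E) E)) 0 0 = _
    rw [hval, coe_glDiagonal, Matrix.diagonal_apply_eq, hkv0]
  · refine Units.ext ?_
    rw [coe_diagUnit]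
    change (adelicVal F E c 3 _ τA : Matrix (Fin 3) (Fin 3) (AdeleRing (𝓞 E) E)) 1 1 = _
    rw [hval, coe_glDiagonal, Matrix.diagonal_apply_eq, hkv1]

end Torus

end UnitaryGroup

end Literature.NumberTheory.Automorphic

end
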